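import Summits.SmoothPoincare4.SmoothPoincare4.Theses.EntropyRung
import Summits.SmoothPoincare4.SmoothPoincare4.Theses.WeylBudget
import Summits.SmoothPoincare4.SmoothPoincare4.Theorems.EntropyRungChangGurskyYangOfClassicalFacts
import Summits.SmoothPoincare4.SmoothPoincare4.Theorems.EntropyRungChangGurskyYangStubPathHarnack
import Literature.Geometry.Riemannian.GurskyViaclovskyPath
import Literature.Geometry.Riemannian.GurskyViaclovskyC0Estimate
import Literature.Geometry.Riemannian.GurskyViaclovskyKappaInvariance
import Literature.Geometry.Riemannian.GurskyViaclovskyC1Estimate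
import Literature.Geometry.Riemannian.GurskyViaclovskyC2Estimate
import Literature.Geometry.Riemannian.GurskyViaclovskyOpenness
import Literature.Geometry.Riemannian.GurskyViaclovskyClosedness
import Literature.Geometry.Riemannian.ChangGurskyYangSmoothness
import Literature.Geometry.Riemannian.ChangGurskyYangSpectral
import Literature.Geometry.Riemannian.ChangGurskyYangTheorem14
import Literature.Geometry.Riemannian.ChangGurskyYangEuler
import Literature.Geometry.Riemannian.ChernGaussBonnetFour
import Literature.Geometry.Riemannian.ChernGaussBonnetFourProofs
import Literature.Geometry.Riemannian.HamiltonConvergenceCriterion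
import HarnessLib

/-!
# Crux `EntropyRung.ChangGurskyYang` (item stmt-SmoothPoincare4-10834) REDUCED, kernel-checked, along the
# line `gv-continuity-path`: the Weyl-weighted Gursky–Viaclovsky continuity method modulo its four
# a-priori / continuity named facts, and Hamilton 1986 §5.2

The crux is VERBATIM the named fact `changGurskyYang_sphere_four` (Chang–Gursky–Yang 2003, Thm. A,
simply connected `scal > 0` case): a closed simply connected smooth 4-manifold carrying a `C^∞`
Riemannian metric with `R > 0` and `∫|W|² dV < 32π²` is diffeomorphic to `S⁴`. CGY §2 reduces it to
Chern–Gauss–Bonnet (a THEOREM of the tree, `chernGaussBonnet_four_holds`), Margerin 1998 Thm. 1 (a theorem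
of the tree MODULO Hamilton 1986 §5.2, `MargerinRails.margerin_theorem_of_convergenceCriterion`, line
`margerin-cone-hamilton-rails`) and CGY Thm. 1.4 (`α = 1`). The line `gv-continuity-path` (skeleton
`Cruxes/ChangGurskyYang/Lines/gv_continuity_path.lean`) opens Thm. 1.4 along Gursky–Viaclovsky's
continuity method (J. Differential Geom. 63 (2003), arXiv:math/0301350, §3–§5) for the WEIGHTED path
`P_t(h) = σ₂(A_h) − ¼|W_h|² + (1−t)(2−t)R_h²/6 = q e^{8u}`, `h = e^{−2u}g`, `t ∈ [δ, 1]`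
(`Literature.Geometry.Riemannian.GurskyViaclovskyPath`). Its registered stubs are now: the Harnack step
`stub_pathHarnack` (PROVED, `…StubPathHarnack`), and four stubs each CLOSED MODULO one named fact filed
by the line — `stub_pathGradient` ⇐ `gurskyViaclovsky_gradientEstimate_weighted_four` (GV Prop. 5),
`stub_pathHessian` ⇐ `gurskyViaclovsky_hessianEstimate_weighted_four` (GV Prop. 6, `C²` part),
`stub_pathOpen` ⇐ `gurskyViaclovsky_pathOpen_weighted_four` (GV Prop. 2 + §5),
`stub_pathClosed` ⇐ `gurskyViaclovsky_pathClosed_weighted_four` (GV Prop. 6 + §5, Evans–Krylov) — plus the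
flow stub `stub_pinchedFlowConvergence` ⇐ `hamilton_convergenceCriterion_four` shared with the rails line.
This file composes them, every other step being a theorem of the tree:

* `pathApriori_of_gvEstimates` — **GV §5's a-priori package** (uniform `C⁰, C¹, C²` bounds along the
  path for solutions with `κ(h) ≥ κ₀ > 0`) from the two estimate facts: sup bound (GV Prop. 3,
  `exists_forall_isPathSolution_le`, PROVED), gradient (fact), Harnack (PROVED), lower bound (GV Prop. 4,
  `IsPathSolution.exists_log_le`, PROVED), Hessian (fact);
* `thm14Psc_of_gvPathFacts` — **CGY Thm. 1.4 in the connected `scal > 0` shape** (Disproof §7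
  `Thm14LeafPsc`) from the four GV facts: `δ ∈ 𝒮` (`exists_pathOperator_pos`, `isPathSolution_self`,
  PROVED), `κ` constant along the path (`IsPathSolution.kappa_eq`, PROVED, Chern–Gauss–Bonnet-free),
  `𝒮 ∩ [δ,1]` closed (a-priori + closedness) and relatively open below `1` (openness), hence `1 ∈ 𝒮`;
* `changGurskyYang_theorem14_four_of_gvPathFacts` — **the tree's apex named fact
  `changGurskyYang_theorem14_four` (CGY Thm. 1.4, `Y > 0`, connected) FOLLOWS from the four GV facts**:
  pass to a conformal `scal > 0` representative (`exists_conformal_sq_scalarCurvature_pos_of_yamabeConstant_pos`,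
  PROVED), transport `κ > 0` (`kappa_eq_of_isConformalTo`), run the path, compose conformal factors —
  so the rails line's STUB 6 is closed modulo the SAME four facts, and the two lines meet;
* `ChangGurskyYang_of_gvPathFacts` — **the crux from the four GV facts and Hamilton §5.2** (CGY §2 p. 121
  line by line: `(0.3) ⇒ (1.2)` by Chern–Gauss–Bonnet and `χ ≥ 2`; Thm. 1.4 psc; "rearranging terms";
  Margerin modulo §5.2; `π₁ = 1` discards `ℝP⁴`); `ChangGurskyYang_weylBudget_of_gvPathFacts` for the
  item's second route decl; `ChangGurskyYang_of_gvPathFacts'` — the same through the rails line's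
  `ChangGurskyYang_of_classicalFacts`, certifying that both conditional closings agree.

It is a CONDITIONAL closing of the item (the gate records a conditional-result; the item closes when the
five facts are discharged). References: [ChangGurskyYang2003] Thm. A, Thm. 1.4, §2; [GurskyViaclovsky2003]
Props. 2–6, §5; [Chen2005] Thm. 1(a); [Margerin1998] Thm. 1; [Hamilton1986] §5 (5.2); [Besse1987] 6.31.
-/

noncomputable section

-- every `Summit.SmoothPoincare4.SmoothPoincare4.…` name repeats the summit = sub-problem segment (D-0017 layout)
set_option linter.dupNamespace false

open scoped Manifold ContDiff Topology ENNReal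
open Set Filter Module
open Literature.Geometry.Lorentzian (PseudoRiemannianMetric riemannianMeasure)
open Literature.Geometry.Lorentzian.PseudoRiemannianMetric
open Literature.Geometry.Riemannian
open Literature.Geometry.Riemannian.GurskyViaclovskyPath
open Literature.Topology.FourManifolds

namespace Summit.SmoothPoincare4.SmoothPoincare4.Theorems.GvContinuityPath

open Summit.SmoothPoincare4.SmoothPoincare4.Theses.EntropyRung (ChangGurskyYang)
open Summit.SmoothPoincare4.SmoothPoincare4.Theorems.MargerinRails
  (margerin_theorem_of_convergenceCriterion ChangGurskyYang_of_classicalFacts)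

variable {M : Type} [TopologicalSpace M] [T2Space M] [SecondCountableTopology M]
  [ChartedSpace (EuclideanSpace ℝ (Fin 4)) M] [IsManifold (𝓡 4) ∞ M] [CompactSpace M]

/-- **Gursky–Viaclovsky 2003, §5: the a-priori package along the Weyl-weighted path, from the two
estimate facts** ("Proposition (upper) implies a uniform upper bound on solutions `u_t` … We may then
apply Proposition (C1estimate) to obtain a uniform gradient bound, and Lemma (C0) then implies a
uniform lower bound on `u_t`. Proposition (C2estimate) then implies …"). On a closed CONNECTED
`(M⁴, g)`, for a smooth positive right side `q`, `δ ≤ 1` and `κ₀ > 0` there is `C` bounding `|u|`,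
`|∇u|²_g` and `|∇²u|²_g` for every smooth admissible solution `(h = e^{−2u}g, u)` at any `t ∈ [δ, 1]`
with `κ(h) ≥ κ₀`. Proof: sup bound `u ≤ C_s` (GV Prop. 3, `exists_forall_isPathSolution_le`, PROVED);
gradient bound (fact GV Prop. 5, applied directly — `stub_pathGradient_of_gradientEstimate` is its
definitional unfolding); Harnack `u x ≤ u y + C₂`
(`stub_pathHarnack`, PROVED); `log(κ₀/∫q dV_g) ≤ 4u(x₁)` at some point (GV Prop. 4,
`IsPathSolution.exists_log_le`, PROVED), whence `u ≥ log(κ₀/∫q dV_g)/4 − C₂`; Hessian bound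
(fact GV Prop. 6, `C²` part; `stub_pathHessian_of_hessianEstimate` is its unfolding). [cite: GurskyViaclovsky2003, Props. 3–6 and §5] -/
theorem pathApriori_of_gvEstimates [ConnectedSpace M]
    (hG : gurskyViaclovsky_gradientEstimate_weighted_four)
    (hH : gurskyViaclovsky_hessianEstimate_weighted_four)
    (g : PseudoRiemannianMetric (𝓡 4) ∞ (EuclideanSpace ℝ (Fin 4)) (TangentSpace (𝓡 4) : M → Type _))
    [g.HasLeviCivita] (hg : g.IsRiemannian)
    (q : M → ℝ) (δ κ₀ : ℝ) (hq : ContMDiff (𝓡 4) 𝓘(ℝ) ∞ q) (hq0 : ∀ x, 0 < q x) (hδ : δ ≤ 1)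
    (hκ₀ : 0 < κ₀) :
    ∃ C : ℝ, ∀ t : ℝ, δ ≤ t → t ≤ 1 →
      ∀ (h : PseudoRiemannianMetric (𝓡 4) ∞ (EuclideanSpace ℝ (Fin 4)) (TangentSpace (𝓡 4) : M → Type _))
        [h.HasLeviCivita] (u : M → ℝ), IsPathSolution g h u t q → κ₀ ≤ kappa h →
        ∀ x, |u x| ≤ C ∧ g.gradSq u x ≤ C ∧ g.normSq x (g.hessian u x) ≤ C := by
  letI : MeasurableSpace M := borel M
  haveI : BorelSpace M := ⟨rfl⟩
  have hqc : Continuous q := hq.continuous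
  -- GV Prop. 3 (PROVED): the sup bound
  obtain ⟨Cs, hCs⟩ := exists_forall_isPathSolution_le g hqc hq0 δ
  -- GV Prop. 5 (fact): the gradient bound under the sup bound
  obtain ⟨C₁, hC₁⟩ := hG M g hg q δ Cs hq hq0 hδ
  -- the Harnack step (PROVED): oscillation bound under the gradient bound
  obtain ⟨C₂, hC₂⟩ := stub_pathHarnack M g hg C₁
  -- the lower bound constant of GV Prop. 4
  set L : ℝ := Real.log (κ₀ / ∫ y, q y ∂(riemannianMeasure (g.toContMDiffRiemannianMetric hg))) / 4
    - C₂ with hL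
  set C₀ : ℝ := max |Cs| |L| with hC₀
  -- GV Prop. 6, `C²` part (fact)
  obtain ⟨C₃, hC₃⟩ := hH M g hg q δ C₀ C₁ hq hq0 hδ
  refine ⟨max (max C₀ C₁) C₃, fun t hδt ht1 h _ u hs hκ x ↦ ?_⟩
  have hsup : ∀ y, u y ≤ Cs := hCs t hδt ht1 h u hs
  have hgrad : ∀ y, g.gradSq u y ≤ C₁ := hC₁ t hδt ht1 h u hs hsup
  have hosc : ∀ y z, u y ≤ u z + C₂ := hC₂ u hs.contMDiff hgrad
  -- GV Prop. 4 (PROVED): `log(κ₀/∫q) ≤ 4 u(x₁)` somewhere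
  obtain ⟨x₁, hx₁⟩ := IsPathSolution.exists_log_le g h hs ht1 hg hqc hq0 hκ₀ hκ
  have hlow : ∀ y, L ≤ u y := fun y ↦ by
    have h1 := hosc x₁ y
    rw [hL]
    linarith
  have habs : ∀ y, |u y| ≤ C₀ := fun y ↦ by
    rw [abs_le]
    constructor
    · have h1 : -|L| ≤ L := neg_abs_le L
      have h2 : |L| ≤ C₀ := le_max_right _ _
      linarith [hlow y]
    · exact ((hsup y).trans (le_abs_self _)).trans (le_max_left _ _)
  have hhess : ∀ y, g.normSq y (g.hessian u y) ≤ C₃ := hC₃ t hδt ht1 h u hs habs hgrad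
  exact ⟨(habs x).trans ((le_max_left _ _).trans (le_max_left _ _)),
    (hgrad x).trans ((le_max_right _ _).trans (le_max_left _ _)), (hhess x).trans (le_max_right _ _)⟩

/-- **CGY 2003 Thm. 1.4 (`α = 1`) in the connected `scal > 0` shape (Disproof §7 `Thm14LeafPsc`), by
Gursky–Viaclovsky's continuity method along the Weyl-weighted path, from the four GV facts.** On a closed
CONNECTED `M⁴`, a `C^∞` Riemannian `g` with `R_g > 0` and `¼∫|W|² < ∫σ₂(A)` is conformal to a `C^∞`
Riemannian metric with `R > 0` and `¼|W|² < σ₂(A)` POINTWISE. With `𝒮 = {t | Solvable g t q}`,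
`q = P_δ(g)`: `δ ∈ 𝒮` (`exists_pathOperator_pos`, `isPathSolution_self`, PROVED), `𝒮 ∩ [δ,1]` is closed
(`pathApriori_of_gvEstimates` with `κ₀ = κ(g)`, constant along solutions by `IsPathSolution.kappa_eq`,
PROVED, + the closedness fact) and relatively open below `1` (the openness fact) — the landed helpers
`stub_pathClosed_of_pathClosed` / `stub_pathOpen_of_pathOpen` are the definitional unfoldings of these facts —
so `1 ∈ 𝒮` (`IsClosed.mem_of_ge_of_forall_exists_gt`); a solution at `t = 1` is the conformal metric
sought (`P_1(h) = σ₂(A_h) − ¼|W_h|² = q e^{8u} > 0`, `R_h > 0`). GV §5: "The implicit function theorem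
… implies that `𝒮` is open … Proposition (C2estimate) then implies that `𝒮` is closed, therefore
`𝒮 = [δ, t₀]`. The metric `g̃ = e^{−2u_{t₀}} g` then satisfies `σ₂(A^{t₀}_{g̃}) > 0` and `R_{g̃} > 0`."
[cite: GurskyViaclovsky2003, §5 (proof of Thm. 1)] [cite: ChangGurskyYang2003, Thm. 1.4 (p. 112) and p. 108] -/
theorem thm14Psc_of_gvPathFacts [ConnectedSpace M]
    (hG : gurskyViaclovsky_gradientEstimate_weighted_four)
    (hH : gurskyViaclovsky_hessianEstimate_weighted_four)
    (hO : gurskyViaclovsky_pathOpen_weighted_four)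
    (hC : gurskyViaclovsky_pathClosed_weighted_four)
    (g : PseudoRiemannianMetric (𝓡 4) ∞ (EuclideanSpace ℝ (Fin 4)) (TangentSpace (𝓡 4) : M → Type _))
    [g.HasLeviCivita] (hg : g.IsRiemannian) (hR : ∀ x, 0 < g.scalarCurvature x)
    (h12 : 1 / 4 * g.weylEnergy.toReal < g.sigma2WeylSchoutenIntegral) :
    ∃ (h : PseudoRiemannianMetric (𝓡 4) ∞ (EuclideanSpace ℝ (Fin 4)) (TangentSpace (𝓡 4) : M → Type _))
      (_ : h.HasLeviCivita) (hh : h.IsRiemannian),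
      IsConformalTo (h.toContMDiffRiemannianMetric hh) (g.toContMDiffRiemannianMetric hg) ∧
      (∀ x, 0 < h.scalarCurvature x) ∧ ∀ x, 1 / 4 * h.weylNormSq x < h.sigma2WeylSchouten x := by
  have hκ : 0 < kappa g := (kappa_pos_iff g).2 h12
  -- the start `δ`, the right side `q := P_δ(g)`, and `δ ∈ 𝒮` (PROVED)
  obtain ⟨δ, hδ1, hqs, hqpos⟩ := exists_pathOperator_pos g hg hR
  set q : M → ℝ := fun x ↦ pathOperator g δ x with hq
  set S : Set ℝ := {t | Solvable g t q} with hS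
  have hδS : δ ∈ S := ⟨g, ‹g.HasLeviCivita›, fun _ ↦ 0, isPathSolution_self g hg hR δ⟩
  -- the uniform bound, with `κ₀ := κ(g)`, valid for every solution since `κ(h) = κ(g)` (PROVED)
  obtain ⟨C, hCb⟩ := pathApriori_of_gvEstimates hG hH g hg q δ (kappa g) hqs hqpos hδ1 hκ
  have hbound : ∀ t : ℝ, δ ≤ t → t ≤ 1 →
      ∀ (h : PseudoRiemannianMetric (𝓡 4) ∞ (EuclideanSpace ℝ (Fin 4)) (TangentSpace (𝓡 4) : M → Type _))
        [h.HasLeviCivita] (u : M → ℝ), IsPathSolution g h u t q →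
        ∀ x, |u x| ≤ C ∧ g.gradSq u x ≤ C ∧ g.normSq x (g.hessian u x) ≤ C :=
    fun t hδt ht1 h _ u hsol ↦ hCb t hδt ht1 h u hsol (IsPathSolution.kappa_eq g h hsol).ge
  -- `𝒮 ∩ [δ, 1]` is closed (fact: closedness)
  have hclosed : IsClosed (S ∩ Icc δ 1) := by
    refine IsSeqClosed.isClosed fun s t hs hst ↦ ?_
    have hsδ : ∀ k, δ ≤ s k := fun k ↦ (hs k).2.1
    have hs1 : ∀ k, s k ≤ 1 := fun k ↦ (hs k).2.2
    refine ⟨?_, ge_of_tendsto' hst hsδ, le_of_tendsto' hst hs1⟩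
    refine hC M g hg q C hqs hqpos s t hst hs1 fun k ↦ ?_
    obtain ⟨h, hLC, u, hsol⟩ := (hs k).1
    exact ⟨h, hLC, u, hsol, hbound (s k) (hsδ k) (hs1 k) h u hsol⟩
  -- openness (fact) + the continuity-method lemma: `1 ∈ 𝒮`
  have h1S : (1 : ℝ) ∈ S := by
    refine hclosed.mem_of_ge_of_forall_exists_gt hδS hδ1 fun x hx ↦ ?_
    obtain ⟨hxS, -, hx1⟩ := hx
    obtain ⟨ε, hε, hε'⟩ := hO M g hg q hqs hqpos x hx1.le hxS
    refine ⟨min (x + ε / 2) 1, hε' _ ?_ ?_ (min_le_right _ _), lt_min (by linarith) hx1,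
      min_le_right _ _⟩
    · have : x < min (x + ε / 2) 1 := lt_min (by linarith) hx1
      linarith
    · exact (min_le_left _ _).trans_lt (by linarith)
  -- the solution at `t = 1` is the conformal metric sought
  obtain ⟨h, hLC, u, hh, hu, hconf, hRh, heq⟩ := h1S
  refine ⟨h, hLC, hh, ?_, hRh, fun x ↦ ?_⟩
  · exact ⟨fun x ↦ Real.exp (-2 * u x), fun x ↦ ⟨Real.exp_pos _, fun v w ↦ by
      simp only [toContMDiffRiemannianMetric_inner, hconf x v w]⟩⟩
  · have hx := heq x
    have hqx : 0 < q x * Real.exp (8 * u x) := mul_pos (hqpos x) (Real.exp_pos _)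
    simp only [pathOperator] at hx
    nlinarith [hx, hqx]

/-- **The tree's apex named fact `changGurskyYang_theorem14_four` (Chang–Gursky–Yang 2003, Thm. 1.4,
`α = 1`, connected, hypothesis `Y(M,[g₀]) > 0`) FOLLOWS from the four Gursky–Viaclovsky facts.** Given
`Y > 0` and `¼∫|W|² < ∫σ₂(A)` at `g₀`: the class contains a `C^∞` metric `g₁ = φ²g₀` with `R > 0`
(first eigenfunction of the conformal Laplacian, `exists_conformal_sq_scalarCurvature_pos_of_yamabeConstant_pos`,
PROVED), `κ(g₁) = κ(g₀) > 0` (`kappa_eq_of_isConformalTo`, PROVED), the path at `g₁` gives a conformal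
`g` with `¼|W|² < σ₂(A)` pointwise (`thm14Psc_of_gvPathFacts`), and `g ∈ [g₁] = [g₀]`
(`IsConformalTo.trans`). This is the passage GV make in §1 ("Since `Y > 0` we may assume `R_g > 0`")
and CGY on p. 108. Consequence: the rails line's conditional closing `ChangGurskyYang_of_classicalFacts`
needs, besides Hamilton §5.2, only these four facts. [cite: ChangGurskyYang2003, Thm. 1.4 (pp. 112–113)]
[cite: GurskyViaclovsky2003, Thm. 1 and §5] -/
theorem changGurskyYang_theorem14_four_of_gvPathFacts :
    gurskyViaclovsky_gradientEstimate_weighted_four → gurskyViaclovsky_hessianEstimate_weighted_four →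
    gurskyViaclovsky_pathOpen_weighted_four → gurskyViaclovsky_pathClosed_weighted_four →
    changGurskyYang_theorem14_four := by
  intro hG hH hO hC N _ _ _ _ _ _ _ _ _ g₀ _ hg₀ hY hint
  -- a conformal `scal > 0` representative (PROVED)
  obtain ⟨φ, -, hφpos, g₁, hLC₁, hg₁, hval, hR₁⟩ :=
    exists_conformal_sq_scalarCurvature_pos_of_yamabeConstant_pos g₀ hg₀ hY
  haveI := hLC₁
  have hconf₁ : IsConformalTo (g₁.toContMDiffRiemannianMetric hg₁)
      (g₀.toContMDiffRiemannianMetric hg₀) :=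
    ⟨fun x ↦ φ x ^ 2, fun x ↦ ⟨pow_pos (hφpos x) 2, fun v w ↦ by
      simp only [toContMDiffRiemannianMetric_inner, hval x v w]⟩⟩
  -- `κ(g₁) = κ(g₀) > 0`
  have hκ₀ : 0 < kappa g₀ := (kappa_pos_iff g₀).2 hint
  have h12 : 1 / 4 * g₁.weylEnergy.toReal < g₁.sigma2WeylSchoutenIntegral := by
    rw [← kappa_pos_iff, kappa_eq_of_isConformalTo g₀ g₁ hg₀ hg₁ hconf₁]
    exact hκ₀
  -- run the path at `g₁`
  obtain ⟨g, hLC, hg, hconf, -, hpt⟩ := thm14Psc_of_gvPathFacts hG hH hO hC g₁ hg₁ hR₁ h12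
  exact ⟨g, hLC, hg, hconf.trans hconf₁, hpt⟩

/-- **The crux `EntropyRung.ChangGurskyYang` (CGY 2003, Thm. A, simply connected psc case) from the four
Gursky–Viaclovsky facts and Hamilton 1986 §5.2.** Proof = CGY 2003 §2 (p. 121) line by line:
`(0.3) ⇒ (1.2)` by Chern–Gauss–Bonnet (THEOREM `chernGaussBonnet_four_holds`) and `χ(M) ≥ 2`
(`quarter_weylEnergy_lt_of_chernGaussBonnet`, PROVED); Thm. 1.4 in the connected psc shape by the weighted
path (`thm14Psc_of_gvPathFacts`) gives a conformal `g'` with `R > 0` and `¼|W|² < σ₂(A)` pointwise;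
"rearranging terms" (`weakPinching_lt_of_sigma2WeylSchouten_gt`, PROVED) gives `WP < 1/6`; Margerin's
theorem modulo §5.2 (`MargerinRails.margerin_theorem_of_convergenceCriterion`, line
`margerin-cone-hamilton-rails`, LANDED) gives `S⁴ ∨ ℝP⁴`; `π₁ = 1` discards `ℝP⁴` (PROVED).
[cite: ChangGurskyYang2003, §2, p. 121] [cite: GurskyViaclovsky2003, §5] [cite: Margerin1998, Thm. 1]
[cite: Hamilton1986, §5, 5.2] -/
theorem ChangGurskyYang_of_gvPathFacts :
    gurskyViaclovsky_gradientEstimate_weighted_four → gurskyViaclovsky_hessianEstimate_weighted_four →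
    gurskyViaclovsky_pathOpen_weighted_four → gurskyViaclovsky_pathClosed_weighted_four →
    hamilton_convergenceCriterion_four → ChangGurskyYang := by
  rintro hG hH hO hC h52 N _ _ _ _ _ _ _ ⟨g, _, hgR, hscal, hW⟩
  have hE : finrank ℝ (EuclideanSpace ℝ (Fin 4)) = 4 := finrank_euclideanSpace_fin
  -- (0.3) ⇒ (1.2): Chern–Gauss–Bonnet (THEOREM) and `χ(M) ≥ 2` (PROVED)
  have h12 : 1 / 4 * g.weylEnergy.toReal < g.sigma2WeylSchoutenIntegral :=
    quarter_weylEnergy_lt_of_chernGaussBonnet g hgR (chernGaussBonnet_four_holds N g hgR) hW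
  -- Thm. 1.4, connected psc shape, by the weighted GV path (modulo the four facts)
  obtain ⟨g', _, hg'R, -, hscal', hpt⟩ := thm14Psc_of_gvPathFacts hG hH hO hC g hgR hscal h12
  have hpos' : ∀ (x : N) (v : TangentSpace (𝓡 4) x), v ≠ 0 → 0 < g'.val x v v :=
    fun x v hv ↦ hg'R x v hv
  -- "rearranging terms": `WP < 1/6` pointwise (PROVED)
  have hWP : ∀ x, g'.weakPinching x < 1 / 6 := fun x ↦
    g'.weakPinching_lt_of_sigma2WeylSchouten_gt (WithTop.coe_le_coe.mpr le_top) hE (hpos' x) (hpt x)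
  -- Margerin modulo §5.2 (rails line, LANDED): `S⁴ ∨ ℝP⁴`; `π₁ = 1` excludes `ℝP⁴`
  rcases margerin_theorem_of_convergenceCriterion h52 N g' hg'R hscal' hWP with h | h
  · exact h
  · exact absurd ‹SimplyConnectedSpace N› (h.not_simplyConnectedSpace (by norm_num))

/-- The same reduction for the item's second route decl `WeylBudget.ChangGurskyYang` (the identical
proposition, `Iff.rfl`). [cite: ChangGurskyYang2003, Thm. A] -/
theorem ChangGurskyYang_weylBudget_of_gvPathFacts
    (hG : gurskyViaclovsky_gradientEstimate_weighted_four)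
    (hH : gurskyViaclovsky_hessianEstimate_weighted_four)
    (hO : gurskyViaclovsky_pathOpen_weighted_four)
    (hC : gurskyViaclovsky_pathClosed_weighted_four)
    (h52 : hamilton_convergenceCriterion_four) :
    Summit.SmoothPoincare4.SmoothPoincare4.Theses.WeylBudget.ChangGurskyYang :=
  ChangGurskyYang_of_gvPathFacts hG hH hO hC h52

/-- **The two lines meet**: the crux also follows by feeding `changGurskyYang_theorem14_four_of_gvPathFacts`
into the rails line's `ChangGurskyYang_of_classicalFacts` (with Chern–Gauss–Bonnet discharged by
`chernGaussBonnet_four_holds`) — a kernel certificate that both conditional closings of the item rest on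
exactly the same five named facts. [cite: ChangGurskyYang2003, §2, p. 121] -/
theorem ChangGurskyYang_of_gvPathFacts'
    (hG : gurskyViaclovsky_gradientEstimate_weighted_four)
    (hH : gurskyViaclovsky_hessianEstimate_weighted_four)
    (hO : gurskyViaclovsky_pathOpen_weighted_four)
    (hC : gurskyViaclovsky_pathClosed_weighted_four)
    (h52 : hamilton_convergenceCriterion_four) : ChangGurskyYang :=
  ChangGurskyYang_of_classicalFacts chernGaussBonnet_four_holds
    (changGurskyYang_theorem14_four_of_gvPathFacts hG hH hO hC) h52

end Summit.SmoothPoincare4.SmoothPoincare4.Theorems.GvContinuityPath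

end
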